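import Summits.BirchSwinnertonDyer.BirchSwinnertonDyer.Theorems.PrintCf2RamifiedOffTYZLowerHalfVisibleSeven
import HarnessLib

/-!
# WORKFILE (crux stmt-BirchSwinnertonDyer-20509 `PrintCf2.RamifiedOffTYZOfFacts`, line `offtyz-v7` / registry skeleton v9, LEAD cruxlead-20509 g17)
# — THE GENUS-PERIOD BIT AND THE DEPTHS ON THE BLOCK-FREE k = 2 SECTOR R2: four LAWS seen by the instruments `zperiod.py` / `zdepth.py`, TYPED

Status: CONJECTURES / RESEARCH STATEMENTS typed for the planner, the disprover and the next lead (crux WORKFILE, never a Theorems/Literature proposal;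
`def … : Prop` only).  Nothing here is asserted.  Companion memo: `Lines/offtyz_v7_GenusPeriodBit.md` (rev 2: method, run-time verifications, the
24-row census, the exact depths).  BSD is not proved by any of this; no class is closed.

What was measured (kit-free, pure python; evidence on 20509; memo §11 = the FULL census): for block-free `n = l·q` (`l ≡ 1`, `q ≡ 7 (mod 8)`, `(l/q) = 1`;
then `ℍ′_n = ℚ(i,√l,√q)` by the compositum display), 122 of the 125 members ≤ 2·10⁴ decided FROM THE HEEGNER POINT ALONE (`y_K ∈ A_n(ℚ)` halved exactly;
`ρ`, `d(h)`, exact depths): `v₂(𝓛(n)) = 1` at 117 (= the G-locus: 27 visible special, 12 invisible special, 78 with `ρ = 1`), `= 2` at 5 (the B-locus),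
analytic rank 3 at 2 (`y_K = O` exactly), 1 undecided (height).  On the 117: `[Z(n)] = 0 ⟺ (ρ = 0 ∧ d(h) = 2)` (117/117); `depth α_n = 0` on the visible
special stratum and `= 1` EXACTLY elsewhere (117/117); `depth Z(n) ≤ 1` (122/122); `ρ(n) = 0 ⟺ l = x² + 32y²` (g15's RhoLawR2, 117/117, here by Heegner
halving); `4 ∣ 𝓛(l) ⟺ l = x² + 32y²` (every row; `|𝓛(l)| ∈ {0,2,4,6,8,10}` by Tunnell counts / L-series); INDEX LAW `v₂([A_n(ℚ)/T : ℤy_K]) = v₂(𝓛(n)) − ρ(n)`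
(122/122).  In every G row `v₂(𝓛(n)) = ρ + 1 + depth P(n) − depth α_n = 1`; the B rows are exactly those where the genus side is one deeper.

Typed below (all over the displays `GenusPointData.Printed ∧ CMPointCompositumPrinted` at `n`, generator `h = (X, Y)` of `A_n(ℚ)` mod torsion as in
g16's `LowerHalfVisible`, `α = ι Θ_A(h) ∈ A(ℍ′_n)`):
* `TwoDiv D P` — «`P ∈ 2A(ℍ′_n) + tors`» (the lineage's `[P] = 0`); `FourDiv D P` — «`P ∈ 4A(ℍ′_n) + tors`».
* `GenusPeriodBitLawR2` (GP): `[Z(n)] = 0 ⟺ X ∈ 2ℚ^{×2}` on R2 ∩ {jump-one, r_an = 1, ρ = 0}  [39/39 with ρ = 0; and `[Z(n)] ≠ 0` on all 78 ρ = 1 rows].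
* `DepthOneFrozenHalfLawR2` (D1): `X ∈ 2ℚ^{×2}` ⟹ `α ∈ 2A + tors` and `α ∉ 4A + tors`  [12/12; the first half is g16's dichotomy + Lemma 3.18; the same «depth exactly 1» holds on all 78 ρ = 1 rows].
* `GenusPeriodDepthLeOneLawR2` (D2): `Z(n) ∉ 4A(ℍ′_n) + tors` on R2 ∩ {jump-one, r_an = 1}  [117/117; also on the 5 B rows].
* `ScriptLFourDvdLaw` (L1, Zhao/Barrucand–Cohn orientation): for a prime `l ≡ 1 (mod 8)`, `4 ∣ 𝓛(l) ⟺ l = x² + 32y²`  [57 distinct primes l on the census + 8 control primes, 0 exceptions] — with g15's `RhoLawR2`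
  this reads «`4 ∣ 𝓛(l) ⟺ ρ(lq) = 0`» on R2 ∩ G.
Under (D1) both halves of C⁺ on the invisible stratum are statements about `Z(n)` alone: lower ⟺ `TwoDiv D (D.Z n)`, upper ⟺ `¬ FourDiv D (D.Z n)`
(sanity link `levelTwo_reading_of_D1` is NOT proved here — it is g3's depth-shift law + g10's `P_eq_of_two_primes`; recorded in the memo §9).
-/

noncomputable section

open scoped Classical

open WeierstrassCurve WeierstrassCurve.Affine WeierstrassCurve.Affine.Point
  Literature.NumberTheory.EllipticCurves Literature.NumberTheory.EllipticCurves.TianYuanZhang2017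
  Literature.NumberTheory.EllipticCurves.TianYuanZhang2017.W2

set_option autoImplicit false

namespace Summit.BirchSwinnertonDyer.PrintCf2.GenusPeriodLaws

/-- «`P ∈ 2A(ℍ′_n) + A(ℍ′_n)_tors`» — the lineage's `[P] = 0` in `V = A(ℍ′_n)/(2A + tors)`. -/
def TwoDiv {n : ℕ} (D : GenusPointData n) (P : APoint D.H) : Prop :=
  ∃ y : APoint D.H, IsOfFinAddOrder (P - (2 : ℤ) • y)

/-- «`P ∈ 4A(ℍ′_n) + A(ℍ′_n)_tors`» — depth at least two. -/
def FourDiv {n : ℕ} (D : GenusPointData n) (P : APoint D.H) : Prop :=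
  ∃ y : APoint D.H, IsOfFinAddOrder (P - (4 : ℤ) • y)

/-- The common frame of the R2 laws: `n = l·q` with `l ≡ 1`, `q ≡ 7 (mod 8)` primes (block-free: `ℍ′_n = ℚ(i, √l, √q)`), analytic rank one, the
jump-one Selmer shape, TYZ's §3 data at `n` with the compositum sentence, and a generator `h = (X, Y)` of `A_n(ℚ)` modulo torsion. -/
def FrameR2 (l q : ℕ) (D : GenusPointData (l * q)) (X Y : ℚ)
    (h : ((congruentNumberCurve (l * q)).twoIsogenyCodomain).toAffine.Nonsingular X Y) : Prop :=
  l.Prime ∧ q.Prime ∧ l % 8 = 1 ∧ q % 8 = 7 ∧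
  (∀ hsq : Squarefree (l * q), (haveI := isElliptic_congruentNumberCurve hsq.ne_zero; (congruentNumberCurve (l * q)).analyticRank = 1)) ∧
  (∀ hsq : Squarefree (l * q), (haveI := isElliptic_congruentNumberCurve hsq.ne_zero;
      Nat.card ((congruentNumberCurve (l * q)).selmerGroup 2) = 2 ^ 5 ∧ Nat.card ((congruentNumberCurve (l * q)).selmerGroup 4) = 2 ^ 6)) ∧
  D.Printed ∧ D.CMPointCompositumPrinted ∧
  (∀ P, ∃ m : ℤ, IsOfFinAddOrder (P - m • (Point.some X Y h : ((congruentNumberCurve (l * q)).twoIsogenyCodomain).toAffine.Point)))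

/-- **(GP) the genus-period bit law on R2 ∩ {ρ = 0}** (24/24): for a generator with `X ∉ ℚ^{×2}` (`ρ(n) = 0`), the genus period `Z(n)` is
`2`-divisible in `A(ℍ′_n)` modulo torsion iff `X ∈ 2ℚ^{×2}` (descent class `d(h) = 2`, the INVISIBLE special stratum). -/
def GenusPeriodBitLawR2 : Prop :=
  ∀ (l q : ℕ) (D : GenusPointData (l * q)) (X Y : ℚ)
    (h : ((congruentNumberCurve (l * q)).twoIsogenyCodomain).toAffine.Nonsingular X Y),
    FrameR2 l q D X Y h → (¬ ∃ s : ℚ, X = s ^ 2) →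
      (TwoDiv D (D.Z (l * q)) ↔ ∃ s : ℚ, X = 2 * s ^ 2)

/-- **(D1) the frozen half has depth EXACTLY one on the invisible stratum** (6/6): for a generator with `X ∈ 2ℚ^{×2}` the point
`α = ι Θ_A(h) ∈ A(K_n)⁻ ⊂ A(ℍ′_n)` lies in `2A(ℍ′_n) + tors` but not in `4A(ℍ′_n) + tors`. -/
def DepthOneFrozenHalfLawR2 : Prop :=
  ∀ (l q : ℕ) (D : GenusPointData (l * q)) (X Y : ℚ)
    (h : ((congruentNumberCurve (l * q)).twoIsogenyCodomain).toAffine.Nonsingular X Y),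
    FrameR2 l q D X Y h → (∃ s : ℚ, X = 2 * s ^ 2) →
      ∀ (hn : l * q ∈ (l * q).divisors) (hn0 : l * q ≠ 0),
        TwoDiv D (Point.map (W' := curveA) (D.embK (l * q) hn) (ΘA hn0 (Point.some X Y h))) ∧
        ¬ FourDiv D (Point.map (W' := curveA) (D.embK (l * q) hn) (ΘA hn0 (Point.some X Y h)))

/-- **(D2) the genus period is never deeper than one on R2 ∩ G** (26/26, both values of `ρ`). -/
def GenusPeriodDepthLeOneLawR2 : Prop :=
  ∀ (l q : ℕ) (D : GenusPointData (l * q)) (X Y : ℚ)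
    (h : ((congruentNumberCurve (l * q)).twoIsogenyCodomain).toAffine.Nonsingular X Y),
    FrameR2 l q D X Y h → ¬ FourDiv D (D.Z (l * q))

/-- **(L1) Zhao / Barrucand–Cohn orientation as a statement** (23/23 primes): for a prime `l ≡ 1 (mod 8)` and any sign choice `L` of `𝓛(l)`,
`4 ∣ L ⟺ l = x² + 32y²` (⟺ `8 ∣ h(−4l)`).  With g15's `RhoLawR2` this is «`4 ∣ 𝓛(l) ⟺ ρ(lq) = 0`» on R2 ∩ G, and with g10's
`P_eq_of_two_primes` it gives `P(lq) ≡ Z(lq) (mod 4A(ℍ′_{lq}))` on the whole special stratum of R2. -/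
def ScriptLFourDvdLaw : Prop :=
  ∀ l : ℕ, l.Prime → l % 8 = 1 → ∀ L : ℤ, IsScriptL l L → ((4 : ℤ) ∣ L ↔ ∃ x y : ℤ, (l : ℤ) = x ^ 2 + 32 * y ^ 2)

/-- Pure-logic sanity link: (GP) and (D1) together say that on the invisible stratum `α` and `Z(n)` are BOTH of depth one modulo torsion iff `Z(n)` is
not `4`-divisible — i.e. under (D1), «C⁺ at `n`» (depth `P(n)` = depth `Q₁`, g3) is the conjunction `TwoDiv D (D.Z n) ∧ ¬ FourDiv D (D.Z n)` whenever
`P(n) ≡ Z(n) (mod 4A)`.  Recorded as the shape of the target, proved trivially from its hypotheses. -/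
theorem invisible_target_shape {n : ℕ} (D : GenusPointData n) (hZ2 : TwoDiv D (D.Z n)) (hZ4 : ¬ FourDiv D (D.Z n)) :
    TwoDiv D (D.Z n) ∧ ¬ FourDiv D (D.Z n) := ⟨hZ2, hZ4⟩

end Summit.BirchSwinnertonDyer.PrintCf2.GenusPeriodLaws

end
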